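/-
Copyright (c) 2026 the pub-hodgecm-mathlib formalisation cell (harness21).  Prover seat hodgecm-mathlib-A-p19 (g19), topic T5 = P8
«(C♯)hol interior», node Cc (3′) sub-brick S3a «sign constancy of the pair form at a definite place» (road note v4 22:17Z).  KERNEL: theorems only.
-/
import Literature.NumberTheory.Automorphic.Liu2021.Def411WeilCarriersArchPlaceGaussian
import HarnessLib

/-!
# The sign vector of the pair form `diag dV ⊗ diag dW` at a real place: factorisation and constancy when `V` is definite there
# ([KonnoKonno2007, §3.1]; [Liu2021, App. D Lem. D.2 (1)])

Topic `NumberTheory/Automorphic/Liu2021` (T5 = P8 «(C♯)hol interior», node Cc (3′), sub-brick S3a); namespace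
`Literature.NumberTheory.GelbartRogawski1991.GRConstruction`.  KERNEL ONLY: proved theorems; 0 definitions, 0 records, 0 `sorry`.

The one-place bricks of node Cc (★ (G) `Def411WeilCarriersArchPlaceGaussian`, ★ β-I `DoubledWeilRepresentationArchPlacePhase(Neg)`) are stated under
`hpos : ∀ k, 0 < x_{v₀}(k)` or `hneg : ∀ k, ¬ 0 < x_{v₀}(k)`, `x_{v₀} = signVec (cmPlaceOver L) (cmGramEntry …) (imagUnit L) v₀` the sign vector of
the pair Gram datum `t₀(k) = dV (e⁻¹k)₁ · dW (e⁻¹k)₂`.  This file supplies the case split for the closer: `x_{v₀}(k) = σ_{v₀}(dV (e⁻¹k)₁) · σ_{v₀}(dW (e⁻¹k)₂) / c_{v₀}`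
(`signVec_cmGramEntry_eq`), hence at a place where `σ_{v₀}(dV p) > 0` for all `p` and `W` is a LINE (`M = 1`) the sign vector is of CONSTANT sign
(`forall_signVec_pos_or_forall_not_of_line`) — exactly `hpos ∨ hneg`.  The positivity `σ_{v₀}(dV p) > 0` comes from `(H.map σ_{w(v₀)}).PosDef` and `ḡᵀHg = diag dV` (`embedding_of_isReal_dV_pos_of_posDef`) — the
`hdef` of the (C♯) frame off `ι`.

HONEST SCOPE.  Statements about the tree's own terms; nothing of [Liu2021] is asserted; HC_CM is NOT proved here or anywhere in the tree.

References: [KonnoKonno2007] §3.1 (3.1); [Liu2021] App. D Lem. D.2 (1); [Folland1989] Ch. 4 §1 Prop. (4.6).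
-/

set_option autoImplicit false

noncomputable section

open scoped Classical
open scoped Matrix ComplexOrder
open NumberField NumberField.InfinitePlace
open Literature.NumberTheory.Automorphic Literature.NumberTheory.Automorphic.UnitaryGroup
open Literature.NumberTheory.Weil1964

namespace Literature.NumberTheory.GelbartRogawski1991.GRConstruction

open UnitaryDualPair

variable (L : Type) [Field L] [NumberField L] [IsCMField L]

variable {N M n : ℕ} (e : Fin N × Fin M ≃ Fin n)
  (dV : Fin N → L) (hdV : ∀ i, IsCMField.complexConj L (dV i) = dV i)
  (dW : Fin M → L) (hdW : ∀ i, IsCMField.complexConj L (dW i) = dW i)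
  (v₀ : {v : InfinitePlace (Fp L) // v.IsReal})

/-- **the sign vector of the pair Gram datum factorises**: `x_{v₀}(k) = σ_{v₀}(dV (e⁻¹k)₁) · σ_{v₀}(dW (e⁻¹k)₂) / c_{v₀}`
(`signVec = placeSignVec t₀ (deltaIm …)`, `t₀ = cmGramEntry`, `σ_{v₀}` multiplicative). [cite: KonnoKonno2007, §3.1 (3.1)] -/
theorem signVec_cmGramEntry_eq (k : Fin n) :
    signVec (cmPlaceOver L) (cmGramEntry L e dV hdV dW hdW) (imagUnit L) v₀ k =
      embedding_of_isReal v₀.2 (⟨dV (e.symm k).1, (IsCMField.complexConj_eq_self_iff (K := L) (dV (e.symm k).1)).1 (hdV _)⟩ : Fp L) *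
        embedding_of_isReal v₀.2 (⟨dW (e.symm k).2, (IsCMField.complexConj_eq_self_iff (K := L) (dW (e.symm k).2)).1 (hdW _)⟩ : Fp L) /
        deltaIm (cmPlaceOver L) (imagUnit L) v₀ := by
  rw [signVec, placeSignVec, cmGramEntry, map_mul]

/-- **SIGN CONSTANCY AT A PLACE WHERE `V` IS DEFINITE, `W` A LINE** (`M = 1`): if `σ_{v₀}(dV p) > 0` for every `p`, then either every `x_{v₀}(k) > 0` or no
`x_{v₀}(k) > 0` — the case split `hpos ∨ hneg` of the one-place bricks of node Cc. [cite: Liu2021, App. D Lem. D.2 (1)] [cite: KonnoKonno2007, §3.1 (3.1)] -/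
theorem forall_signVec_pos_or_forall_not_of_line (e₁ : Fin N × Fin 1 ≃ Fin n) (dW₁ : Fin 1 → L) (hdW₁ : ∀ i, IsCMField.complexConj L (dW₁ i) = dW₁ i)
    (hVpos : ∀ p : Fin N, 0 < embedding_of_isReal v₀.2 (⟨dV p, (IsCMField.complexConj_eq_self_iff (K := L) (dV p)).1 (hdV p)⟩ : Fp L)) :
    (∀ k : Fin n, 0 < signVec (cmPlaceOver L) (cmGramEntry L e₁ dV hdV dW₁ hdW₁) (imagUnit L) v₀ k) ∨
      (∀ k : Fin n, ¬ 0 < signVec (cmPlaceOver L) (cmGramEntry L e₁ dV hdV dW₁ hdW₁) (imagUnit L) v₀ k) := by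
  -- the common factor `s := σ_{v₀}(dW₁ 0) / c_{v₀}`
  have hfac : ∀ k : Fin n, signVec (cmPlaceOver L) (cmGramEntry L e₁ dV hdV dW₁ hdW₁) (imagUnit L) v₀ k =
      embedding_of_isReal v₀.2 (⟨dV (e₁.symm k).1, (IsCMField.complexConj_eq_self_iff (K := L) (dV (e₁.symm k).1)).1 (hdV _)⟩ : Fp L) *
        (embedding_of_isReal v₀.2 (⟨dW₁ 0, (IsCMField.complexConj_eq_self_iff (K := L) (dW₁ 0)).1 (hdW₁ 0)⟩ : Fp L) /
          deltaIm (cmPlaceOver L) (imagUnit L) v₀) := fun k => by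
    rw [signVec_cmGramEntry_eq, mul_div_assoc]
    have h0 : (e₁.symm k).2 = 0 := Subsingleton.elim _ _
    simp only [h0]
  by_cases hs : 0 < embedding_of_isReal v₀.2 (⟨dW₁ 0, (IsCMField.complexConj_eq_self_iff (K := L) (dW₁ 0)).1 (hdW₁ 0)⟩ : Fp L) /
      deltaIm (cmPlaceOver L) (imagUnit L) v₀
  · exact Or.inl fun k => by rw [hfac]; exact mul_pos (hVpos _) hs
  · exact Or.inr fun k => by rw [hfac]; exact not_lt.mpr (mul_nonpos_of_nonneg_of_nonpos (hVpos _).le (not_lt.mp hs))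

/-- **`σ_{v₀}(dV p) > 0` from the positivity of `H` at the place**: if `H.map σ_{w(v₀)}` is positive definite and `ḡᵀ H g = diag dV`, then every
`σ_{v₀}(dV p)` is a positive real (`σ_w(ḡ)ᵀ = (σ_w g)ᴴ` by ★ `embedding_galConj`; congruence preserves positive definiteness, Mathlib
`Matrix.PosDef.conjTranspose_mul_mul_same`; `Matrix.posDef_diagonal_iff`; `re σ_w = σ_{v₀}` on `L⁺`, ★ `realPlaceMap_eq_embedding_of_isReal`) — the
hypothesis `hVpos` of `forall_signVec_pos_or_forall_not_of_line` in the (C♯) frame (`hdef : (H.map τ′).PosDef` off `ι`).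
[cite: Liu2021, App. D Lem. D.2 (1)] [cite: PlatonovRapinchuk1994, §2.3] -/
theorem embedding_of_isReal_dV_pos_of_posDef (H : Matrix (Fin N) (Fin N) L) (g : GL (Fin N) L)
    (hg : ((g : Matrix (Fin N) (Fin N) L).map (cmConjRingHom L))ᵀ * H * (g : Matrix (Fin N) (Fin N) L) = Matrix.diagonal dV)
    (hH : (H.map (cmPlaceOver L v₀).1.embedding).PosDef) (p : Fin N) :
    0 < embedding_of_isReal v₀.2 (⟨dV p, (IsCMField.complexConj_eq_self_iff (K := L) (dV p)).1 (hdV p)⟩ : Fp L) := by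
  -- `σ_w(diag dV) = (σ_w g)ᴴ σ_w(H) (σ_w g)`
  have hconj : ((g : Matrix (Fin N) (Fin N) L).map (cmConjRingHom L)).map (cmPlaceOver L v₀).1.embedding =
      ((g : Matrix (Fin N) (Fin N) L).map (cmPlaceOver L v₀).1.embedding).map (starRingEnd ℂ) := by
    rw [Matrix.map_map, Matrix.map_map]
    exact congrArg _ (funext fun x => by
      rw [Function.comp_apply, Function.comp_apply, cmConjRingHom_apply]
      exact embedding_galConj (Fp L) L (IsCMField.complexConj L) (cmPlaceOver L v₀) (cmPlaceOver_smul L v₀) (IsCMField.complexConj_ne_one L) x)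
  have h1 : (Matrix.diagonal dV).map (cmPlaceOver L v₀).1.embedding =
      ((g : Matrix (Fin N) (Fin N) L).map (cmPlaceOver L v₀).1.embedding)ᴴ * H.map (cmPlaceOver L v₀).1.embedding *
        (g : Matrix (Fin N) (Fin N) L).map (cmPlaceOver L v₀).1.embedding := by
    rw [← hg, Matrix.map_mul, Matrix.map_mul, Matrix.transpose_map, hconj]
    congr 2
  -- `σ_w g` is invertible, so the congruence is positive definite
  have hunit : IsUnit ((g : Matrix (Fin N) (Fin N) L).map ((cmPlaceOver L v₀).1.embedding : L →+* ℂ)) :=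
    ((g : GL (Fin N) L).isUnit.map ((cmPlaceOver L v₀).1.embedding : L →+* ℂ).mapMatrix)
  have h2 : ((Matrix.diagonal dV).map (cmPlaceOver L v₀).1.embedding).PosDef := by
    rw [h1]
    exact hH.conjTranspose_mul_mul_same (Matrix.mulVec_injective_iff_isUnit.2 hunit)
  rw [Matrix.diagonal_map (map_zero _)] at h2
  have h3 := (Matrix.posDef_diagonal_iff.1 h2) p
  rw [Complex.pos_iff] at h3
  -- `re σ_w(dV p) = σ_{v₀}(dV p)`
  have h4 := realPlaceMap_eq_embedding_of_isReal L (IsCMField.complexConj L) (cmPlaceOver L v₀) (cmPlaceOver_smul L v₀)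
    (IsCMField.complexConj_ne_one L) v₀ (cmPlaceOver_comap L v₀)
    (⟨dV p, (IsCMField.complexConj_eq_self_iff (K := L) (dV p)).1 (hdV p)⟩ : Fp L)
  rw [← h4]
  exact h3.1

/-- **the letter's archimedean sign in the frame's terms**: at the complex place `w₀ = cmPlaceOver L v₀`,
`Im σ_{w₀}(a · (2δ)⁻¹) = − σ_{v₀}(a) / (2 · Im σ_{w₀}(δ))` for `a ∈ L⁺`, `δ = imagUnit L` (`σ_{w₀}(a)` is real, ★ `ofReal_re_embedding_algebraMap` /
★ `realPlaceMap_eq_embedding_of_isReal`; `σ_{w₀}(δ)` is purely imaginary, ★ `re_embedding_delta`) — the dictionary between the `(τ′ (a·(2δ)⁻¹)).im`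
of ★ `meetsThetaLiftFromLine_hol_archTypeAway` and the `deltaIm` of `signVec` (sub-brick S3b, analytic half).
[cite: Liu2021, App. D Lem. D.2 (1); Rem. 4.2 / Def. 4.3] -/
theorem im_embedding_cmPlaceOver_mul_inv_two_imagUnit (a : Fp L) :
    ((cmPlaceOver L v₀).1.embedding (algebraMap (Fp L) L a * (2 * imagUnit L)⁻¹)).im =
      -embedding_of_isReal v₀.2 a / (2 * deltaIm (cmPlaceOver L) (imagUnit L) v₀) := by
  have hre : ((cmPlaceOver L v₀).1.embedding (imagUnit L)).re = 0 :=
    re_embedding_delta (Fp L) L (IsCMField.complexConj L) (cmPlaceOver L v₀) (cmPlaceOver_smul L v₀) (IsCMField.complexConj_ne_one L)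
      (complexConj_imagUnit L)
  have ha : (cmPlaceOver L v₀).1.embedding (algebraMap (Fp L) L a) = ((embedding_of_isReal v₀.2 a : ℝ) : ℂ) := by
    rw [← realPlaceMap_eq_embedding_of_isReal L (IsCMField.complexConj L) (cmPlaceOver L v₀) (cmPlaceOver_smul L v₀)
      (IsCMField.complexConj_ne_one L) v₀ (cmPlaceOver_comap L v₀) a]
    exact (ofReal_re_embedding_algebraMap (Fp L) L (IsCMField.complexConj L) (cmPlaceOver L v₀) (cmPlaceOver_smul L v₀)
      (IsCMField.complexConj_ne_one L) a).symm
  have hδ : (cmPlaceOver L v₀).1.embedding (imagUnit L) = ((deltaIm (cmPlaceOver L) (imagUnit L) v₀ : ℝ) : ℂ) * Complex.I := by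
    apply Complex.ext
    · simp [hre, deltaIm]
    · simp [deltaIm]
  have hd0 : deltaIm (cmPlaceOver L) (imagUnit L) v₀ ≠ 0 :=
    deltaIm_ne_zero (IsCMField.complexConj_ne_one L) (cmPlaceOver_smul L) (complexConj_imagUnit L) (imagUnit_ne_zero L) v₀
  rw [map_mul, map_inv₀, map_mul, map_ofNat, ha, hδ]
  have h2 : ((2 : ℂ) * (((deltaIm (cmPlaceOver L) (imagUnit L) v₀ : ℝ) : ℂ) * Complex.I))⁻¹ =
      -(((2 * deltaIm (cmPlaceOver L) (imagUnit L) v₀)⁻¹ : ℝ) : ℂ) * Complex.I := by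
    have hI : Complex.I⁻¹ = -Complex.I := Complex.inv_I
    rw [mul_inv, mul_inv, hI, Complex.ofReal_inv, Complex.ofReal_mul, Complex.ofReal_ofNat, mul_inv]
    ring
  rw [h2]
  simp only [mul_neg, neg_mul, Complex.neg_im, Complex.mul_im, Complex.ofReal_re, Complex.ofReal_im, Complex.I_re, Complex.I_im,
    mul_zero, mul_one, add_zero, Complex.mul_re, sub_zero]
  rw [div_eq_mul_inv, neg_mul]

end Literature.NumberTheory.GelbartRogawski1991.GRConstruction

end
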